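import Summits.Langlands.Langlands.Theorems.SoloInformedFontaineMazurGL1General
import Literature.NumberTheory.PAdicHodge.LubinTateCharacterConjugatesTotallyRamifiedAnyPrime
import HarnessLib

/-!
# SoloInformedDeRhamGL1TotallyRamifiedAnyPrime — de Rham ⇒ locally algebraic for rank-one `p`-adic
# representations of `Γ_F`, for EVERY totally ramified `F/ℚ_p` and EVERY prime `p` (solo-Langlands-informed s112)

`SoloInformedDeRhamGL1TotallyRamified` proved Tate's theorem (de Rham ⇒ locally algebraic, rank one) for every
totally ramified `F/ℚ_p` with `p ≥ 3`, the restriction coming from the level-one non-vanishing step of the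
Literature theorem `lubinTateCharacterConjugateAdmissible_of_totallyRamified`.  The Literature theorem
`lubinTateCharacterConjugateAdmissible_of_finrank_eq` (`LubinTateCharacterConjugatesTotallyRamifiedAnyPrime`:
the level-two estimate `‖θ_ρ(x_t)‖ = ‖ρ − π‖·‖t₁‖`, valid for every `q ≥ 2`) removes it.  Hence:

★ `exists_isOpen_eq_prod_of_isDeRhamFramed_totallyRamified'` — for every totally ramified `F/ℚ_p` (any `p`,
`[F : ℚ_p] = deg f` for an Eisenstein datum `D = (f, π)` of `F` whose root `π` is the uniformizer, `#k_F = p`),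
every de Rham framed character `r : Γ_F → GL₁(ℚ̄_p)` is locally algebraic: `r(w) = ∏_e e(Art_F w)^{n_e}` on an
open subgroup of inertia.  The residue-degree `f ≥ 2` case remains conditional on (H).

References: J.-P. Serre, *Abelian ℓ-adic representations and elliptic curves* (1968), Ch. III App. A
[SerreAbelianLadic1968]; J. Tate, *p-divisible groups* (1967), §3.3 [Tate1967]; P. Colmez, Ann. of
Math. 138 (1993) §I.2 [Colmez1993]; S. Lang, *Cyclotomic Fields I and II* (1990), Ch. 8 §6 [LangCyclotomic1990].
-/

noncomputable section

open ValuativeRel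
open scoped MatrixGroups

namespace Summit.Langlands.Langlands.Theorems

open Literature.NumberTheory.PAdicHodge
open Literature.NumberTheory.GaloisRepresentations
open Literature.NumberTheory.GaloisRepresentations.IsNonarchimedeanLocalField
open Literature.NumberTheory.LocalFields
open Field

/-- ★ **Tate's theorem (de Rham ⇒ locally algebraic) for rank one over every totally ramified `F/ℚ_p`, every
prime `p` — unconditionally.** Hypotheses: an Eisenstein datum `D` of `F` whose root is the uniformizer `π`,
`#k_F = p`, `[F : ℚ_p] = deg f = e`.
[cite: SerreAbelianLadic1968, Ch. III §A.5–A.7] [cite: Tate1967, §3.3 Thm. 2 and Cor. 2] [cite: Colmez1993, §I.2] -/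
theorem exists_isOpen_eq_prod_of_isDeRhamFramed_totallyRamified'
    {F : Type} [Field F] [ValuativeRel F] [TopologicalSpace F] [IsNonarchimedeanLocalField F]
    [CharZero F] {p : ℕ} [Fact p.Prime] (hp : valuation F p < 1) (D : EisensteinRoot F p hp)
    {π : 𝒪[F]} (hπ : (valuation F).IsUniformizer (π : F)) (hπD : (π : F) = D.root)
    (hk : residueFieldCard F = p) (hd : Module.finrank (PadicBase F p hp) F = D.e)
    (r : FramedRep (absoluteGaloisGroup F) (PadicAlgCl p) 1)
    (hr : (fontainePst F p hp).IsDeRhamFramed r) :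
    ∃ V : Subgroup Fˣ, IsOpen (V : Set Fˣ) ∧
      ∃ (s : Finset (F →+* PadicAlgCl p)) (n : (F →+* PadicAlgCl p) → ℤ),
        (∀ e ∈ s, Continuous e) ∧ ∀ w ∈ WeilGroup.inertia F, canonicalArtin F w ∈ V →
          ((r (WeilGroup.toAbsGalois F w) : GL (Fin 1) (PadicAlgCl p)) :
              Matrix (Fin 1) (Fin 1) (PadicAlgCl p)) 0 0 =
            ∏ e ∈ s, e ((canonicalArtin F w : Fˣ) : F) ^ n e :=
  exists_isOpen_eq_prod_of_isDeRhamFramed_general hp hπ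
    (lubinTateCharacterConjugateAdmissible_of_finrank_eq D hπ hπD hk hd) r hr

/-- The hypothesis (H) of the `GL₁` files, discharged for totally ramified `F` and every `p` (re-export under the
summit namespace, for the assembly files). [cite: SerreAbelianLadic1968, Ch. III §A.5] [cite: Colmez1993, §I.2] -/
theorem lubinTateCharacterConjugateAdmissible_totallyRamified'
    {F : Type} [Field F] [ValuativeRel F] [TopologicalSpace F] [IsNonarchimedeanLocalField F]
    [CharZero F] {p : ℕ} [Fact p.Prime] (hp : valuation F p < 1) (D : EisensteinRoot F p hp)
    {π : 𝒪[F]} (hπ : (valuation F).IsUniformizer (π : F)) (hπD : (π : F) = D.root)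
    (hk : residueFieldCard F = p) (hd : Module.finrank (PadicBase F p hp) F = D.e) :
    LubinTateCharacterConjugateAdmissible F p hp hπ :=
  lubinTateCharacterConjugateAdmissible_of_finrank_eq D hπ hπD hk hd

end Summit.Langlands.Langlands.Theorems

end
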